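import Literature.Computability.Complexity.SamplingChernoff
import Literature.Computability.Complexity.SubsetHitting
import Literature.Computability.Complexity.AveragingCounting
import HarnessLib

/-!
# Uniform direct-product decoding (Impagliazzo–Jaiswal–Kabanets–Wigderson), I: the set-up

Trunk T-CPLX-CORE. Fourth instalment of the decomposition of the named fact
`Literature.Computability.Learning.cikk_natural_implies_learning` (CIKK 2016, Thm. 5.1), covering
CIKK Thm. 4.1 = the uniform direct-product decoding theorem of Impagliazzo–Jaiswal–Kabanets–
Wigderson (SIAM J. Comput. 39 (2010), Thm. 1.2 with §3), in exact finite counting form and in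
the variant used by a learner with MEMBERSHIP QUERIES:

* the `k`-wise direct product is taken over `k`-TUPLES `B : Fin k → U` (IJKW, footnote 3),
  the "trusted set" is a uniformly random set `P` of `s` POSITIONS together with a tuple
  `a` read on `P` (IJKW's `A`), and a completion of `(P, a)` is `fill P a y`
  (`y : Fin k → U`, coordinates of `y` inside `P` are ignored);
* the values trusted on `P` are the TRUE values `v = f ∘ a` (obtained by membership queries)
  rather than IJKW's `C(B₀)|_A`: this is the classical advice of direct-product decoders
  (IJKW §1.4.1) combined with IJKW's consistency sampling; the analysis below is IJKW §3
  verbatim with the component `B₀` removed (so "good"/"excellent" are properties of `(P, a)`).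

This file: the objects (`fill`, `errSet`, `cons`, `corr`, the decoder `decode` = IJKW's
circuit `C_{A,v}` with its internal randomness `steps` FIXED, Algorithm 1), the re-randomisation
identity `sum_sum_fill` (choosing `(a, y)` and reading `fill P a y` is uniform), and the two
abundance statements: good rows are abundant (IJKW Lemma 3.12, `card_good_ge`) and excellent
rows are abundant (IJKW Lemma 3.11, `card_excellent_ge`, via the hitting property of random
position sets, `card_avoiding_le_exp`). The sampler arguments (IJKW Lemmas 3.9, 3.10) are in
`DirectProductSampler.lean`, the decoder analysis (Lemma 3.8, Remark 3.3, Thm. 1.2) in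
`DirectProductDecoder.lean`. Everything is proved; constants are explicit (they differ from
IJKW's, whose Thm. 3.2 bookkeeping is only up to constants).

## References

* R. Impagliazzo, R. Jaiswal, V. Kabanets, A. Wigderson, *Uniform direct product theorems:
  simplified, optimized, and derandomized*, SIAM J. Comput. 39(4) (2010) 1637–1665, Thm. 1.2,
  Algorithms 1–2, Defs. 3.5–3.7, Lemmas 3.11–3.12 [ImpagliazzoEtAl2010] (text checked).
* M. Carmosino, R. Impagliazzo, V. Kabanets, A. Kolokolova, *Learning algorithms from natural
  proofs*, CCC 2016, Thm. 4.1 ("DP Reconstruction") [CarmosinoImpagliazzoKabanetsKolokolova2016].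
-/

open Finset Real

namespace Literature.Computability.Complexity

namespace DirectProduct

variable {U R : Type*} [Fintype U] [DecidableEq R] {k : ℕ}

/-! ### Completions, errors, consistency -/

/-- **Completion** of the partial tuple `a|_P` by `y`: `a` on the positions of `P`, `y` elsewhere
(IJKW: the `k`-sets `B' ⊇ A`; here tuples and a position set). [cite: ImpagliazzoEtAl2010, §3] -/
def fill (P : Finset (Fin k)) (a y : Fin k → U) : Fin k → U := fun i => if i ∈ P then a i else y i

omit [Fintype U] in
/-- On `P` the completion reads `a`. [folklore] -/
@[simp] theorem fill_apply_of_mem {P : Finset (Fin k)} {i : Fin k} (hi : i ∈ P) (a y : Fin k → U) :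
    fill P a y i = a i := by simp [fill, hi]

omit [Fintype U] in
/-- Off `P` the completion reads `y`. [folklore] -/
@[simp] theorem fill_apply_of_not_mem {P : Finset (Fin k)} {i : Fin k} (hi : i ∉ P)
    (a y : Fin k → U) : fill P a y i = y i := by simp [fill, hi]

omit [Fintype U] in
/-- `fill P (fill P a y) (fill P y a) = a`: the swap `(a, y) ↦ (fill P a y, fill P y a)` is an
involution. [folklore] -/
theorem fill_fill_fill (P : Finset (Fin k)) (a y : Fin k → U) :
    fill P (fill P a y) (fill P y a) = a := by
  funext i; by_cases hi : i ∈ P <;> simp [fill, hi]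

omit [Fintype U] in
/-- The swap `(a, y) ↦ (fill P a y, fill P y a)` is an involution of pairs of tuples. [folklore] -/
theorem fillSwap_involutive (P : Finset (Fin k)) :
    Function.Involutive (fun p : (Fin k → U) × (Fin k → U) => (fill P p.1 p.2, fill P p.2 p.1)) :=
  fun p => by simp only [fill_fill_fill]

/-- **Re-randomisation**: reading the completion `fill P a y` of a uniform pair `(a, y)` gives a
uniform tuple — `Σ_{a,y} g (fill P a y) = |U|^k · Σ_B g B`. [folklore] -/
theorem sum_sum_fill (P : Finset (Fin k)) (g : (Fin k → U) → ℝ) :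
    ∑ a : Fin k → U, ∑ y : Fin k → U, g (fill P a y) =
      Fintype.card (Fin k → U) * ∑ B : Fin k → U, g B := by
  rw [← Fintype.sum_prod_type', Finset.mul_sum]
  calc (∑ p : (Fin k → U) × (Fin k → U), g (fill P p.1 p.2))
      = ∑ p : (Fin k → U) × (Fin k → U), g p.1 :=
        Fintype.sum_equiv (Function.Involutive.toPerm _ (fillSwap_involutive (U := U) P))
          _ _ fun _ => rfl
    _ = ∑ B : Fin k → U, ∑ _y : Fin k → U, g B := Fintype.sum_prod_type _
    _ = ∑ B : Fin k → U, (Fintype.card (Fin k → U) : ℝ) * g B := by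
        refine Finset.sum_congr rfl fun B _ => ?_
        rw [Finset.sum_const, nsmul_eq_mul, Finset.card_univ]

variable (C : (Fin k → U) → Fin k → R) (f : U → R)

/-- The **error set** of the oracle `C` on the tuple `B`: positions where `C(B)` disagrees with
`f^k(B)` (IJKW Def. 3.5, `Err(B)`). [cite: ImpagliazzoEtAl2010, Def. 3.5] -/
def errSet (B : Fin k → U) : Finset (Fin k) := univ.filter fun i => C B i ≠ f (B i)

omit [Fintype U] in
/-- Membership in the error set. [folklore] -/
@[simp] theorem mem_errSet {B : Fin k → U} {i : Fin k} : i ∈ errSet C f B ↔ C B i ≠ f (B i) := by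
  simp [errSet]

omit [Fintype U] in
/-- `C(B) = f^k(B)` iff the error set is empty (IJKW: `B` is "correct"). [cite: ImpagliazzoEtAl2010, Def. 3.5] -/
theorem errSet_eq_empty_iff (B : Fin k → U) : errSet C f B = ∅ ↔ ∀ i, C B i = f (B i) := by
  simp [errSet, filter_eq_empty_iff]

/-- The **consistent completions** of `(P, a)` (IJKW's `Cons`): those `y` for which `C` is right
on every position of `P` of the completion — with the true values `f (a i)` trusted on `P`,
consistency means `P ∩ Err(fill P a y) = ∅`. [cite: ImpagliazzoEtAl2010, §3 (the set Cons)] -/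
def cons (P : Finset (Fin k)) (a : Fin k → U) : Finset (Fin k → U) :=
  univ.filter fun y => Disjoint P (errSet C f (fill P a y))

/-- The **correct completions** of `(P, a)`: `C` is right on every position.
[cite: ImpagliazzoEtAl2010, Def. 3.5] -/
def corr (P : Finset (Fin k)) (a : Fin k → U) : Finset (Fin k → U) :=
  univ.filter fun y => errSet C f (fill P a y) = ∅

variable {C f} in
/-- Membership in `cons`. [folklore] -/
@[simp] theorem mem_cons {P : Finset (Fin k)} {a y : Fin k → U} :
    y ∈ cons C f P a ↔ Disjoint P (errSet C f (fill P a y)) := by simp [cons]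

variable {C f} in
/-- Membership in `corr`. [folklore] -/
@[simp] theorem mem_corr {P : Finset (Fin k)} {a y : Fin k → U} :
    y ∈ corr C f P a ↔ errSet C f (fill P a y) = ∅ := by simp [corr]

/-- Correct completions are consistent. [cite: ImpagliazzoEtAl2010, §3.1] -/
theorem corr_subset_cons (P : Finset (Fin k)) (a : Fin k → U) : corr C f P a ⊆ cons C f P a := by
  intro y hy
  rw [mem_corr] at hy
  simp [mem_cons, hy]

/-- A row `(P, a)` is **good** if at least `ε'·|U|^k` of its completions are correct
(IJKW Def. 3.6 without the component `B₀`). [cite: ImpagliazzoEtAl2010, Def. 3.6] -/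
def Good (ε' : ℝ) (P : Finset (Fin k)) (a : Fin k → U) : Prop :=
  ε' * Fintype.card (Fin k → U) ≤ (corr C f P a).card

/-- `Good` is decidable (classically, through `ℝ`). [folklore] -/
noncomputable instance (ε' : ℝ) (P : Finset (Fin k)) (a : Fin k → U) :
    Decidable (Good C f ε' P a) := by
  unfold Good; infer_instance

/-- The total number of errors over the consistent completions of `(P, a)` (the numerator of
IJKW's `Exp_{B' ∈ Cons}[err(B')]`, scaled by `(k - s)|Cons|`). [cite: ImpagliazzoEtAl2010, Def. 3.7] -/
def consErr (P : Finset (Fin k)) (a : Fin k → U) : ℕ :=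
  ∑ y ∈ cons C f P a, (errSet C f (fill P a y)).card

/-- A row `(P, a)` is **`α`-excellent** if it is good and its consistent completions carry on
average at most an `α` fraction of errors on the `k - |P|` free positions
(IJKW Def. 3.7 without `B₀`). [cite: ImpagliazzoEtAl2010, Def. 3.7] -/
def Excellent (ε' α : ℝ) (P : Finset (Fin k)) (a : Fin k → U) : Prop :=
  Good C f ε' P a ∧ (consErr C f P a : ℝ) ≤ α * (k - P.card) * (cons C f P a).card

/-- `Excellent` is decidable (classically, through `ℝ`). [folklore] -/
noncomputable instance (ε' α : ℝ) (P : Finset (Fin k)) (a : Fin k → U) :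
    Decidable (Excellent C f ε' α P a) := by
  unfold Excellent; infer_instance

/-! ### The decoder (IJKW Algorithm 1 with fixed internal randomness) -/

/-- The tuple queried by one sampling step `σ = (j, y)` on the challenge `x`: put `x` at
position `j`, fill the other free positions by `y`, keep `a` on `P`.
[cite: ImpagliazzoEtAl2010, Algorithm 1] -/
def stepTuple (P : Finset (Fin k)) (a : Fin k → U) (x : U) (σ : Fin k × (Fin k → U)) :
    Fin k → U :=
  fill P a (Function.update σ.2 σ.1 x)

/-- A sampling step **answers** when its position is free and `C` is consistent with the trusted
values `v` on `P`. [cite: ImpagliazzoEtAl2010, Algorithm 1] -/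
def Answers (P : Finset (Fin k)) (a : Fin k → U) (v : Fin k → R) (x : U)
    (σ : Fin k × (Fin k → U)) : Prop :=
  σ.1 ∉ P ∧ ∀ i ∈ P, C (stepTuple P a x σ) i = v i

/-- `Answers` is decidable. [folklore] -/
instance (P : Finset (Fin k)) (a : Fin k → U) (v : Fin k → R) (x : U)
    (σ : Fin k × (Fin k → U)) : Decidable (Answers C P a v x σ) := by
  unfold Answers; infer_instance

/-- The decoder on a LIST of sampling steps: the answer `C(B')_j` of the first answering step,
the default `d₀` if none answers. [cite: ImpagliazzoEtAl2010, Algorithm 1] -/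
def decodeList (P : Finset (Fin k)) (a : Fin k → U) (v : Fin k → R) (d₀ : R) (x : U) :
    List (Fin k × (Fin k → U)) → R
  | [] => d₀
  | σ :: l => if Answers C P a v x σ then C (stepTuple P a x σ) σ.1 else decodeList P a v d₀ x l

/-- **The direct-product decoder** `C_{A,v}` of IJKW (Algorithm 1) with its `t` sampling steps
fixed in advance (IJKW Remark 3.3): trusted positions `P`, trusted tuple `a` (read on `P`),
trusted values `v` (meant to be `f ∘ a`), default `d₀`.
[cite: ImpagliazzoEtAl2010, Algorithm 1 and Remark 3.3] -/
def decode (P : Finset (Fin k)) (a : Fin k → U) (v : Fin k → R) (d₀ : R) {t : ℕ}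
    (steps : Fin t → Fin k × (Fin k → U)) (x : U) : R :=
  decodeList C P a v d₀ x (List.ofFn steps)

/-! ### Good rows are abundant (IJKW Lemma 3.12) -/

/-- Averaging: if `g ≤ M` on `S` and `Σ_S g ≥ ρ M |S|`, then `g ≥ θ M` on at least `(ρ - θ)|S|`
elements of `S` (`M ≥ 0`, `θ ≥ 0`). [folklore] -/
theorem card_filter_ge_of_sum_ge {ι : Type*} (S : Finset ι) (g : ι → ℝ) {M ρ θ : ℝ}
    (hM : 0 < M) (hθ : 0 ≤ θ) (hle : ∀ i ∈ S, g i ≤ M) (hsum : ρ * M * S.card ≤ ∑ i ∈ S, g i) :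
    (ρ - θ) * S.card ≤ ((S.filter fun i => θ * M ≤ g i).card : ℝ) := by
  classical
  set T := S.filter fun i => θ * M ≤ g i
  have hsplit : ∑ i ∈ S, g i ≤ T.card * M + (S.card - T.card) * (θ * M) := by
    rw [← Finset.sum_filter_add_sum_filter_not S (fun i => θ * M ≤ g i)]
    refine add_le_add ?_ ?_
    · rw [← nsmul_eq_mul, ← Finset.sum_const]
      exact Finset.sum_le_sum fun i hi => hle i (mem_filter.1 hi).1
    · have hc : ((S.filter fun i => ¬ θ * M ≤ g i).card : ℝ) = S.card - T.card := by
        have := Finset.card_filter_add_card_filter_not (s := S) (fun i => θ * M ≤ g i)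
        rw [eq_sub_iff_add_eq, add_comm]; exact_mod_cast this
      rw [← hc, ← nsmul_eq_mul, ← Finset.sum_const]
      exact Finset.sum_le_sum fun i hi => (not_le.1 (mem_filter.1 hi).2).le
  have hT : (T.card : ℝ) ≤ S.card := by exact_mod_cast card_filter_le _ _
  have hT0 : (0 : ℝ) ≤ T.card := Nat.cast_nonneg _
  have hmain : (ρ - θ) * S.card * M ≤ T.card * M := by
    have h1 : (ρ - θ) * S.card * M ≤ T.card * M * (1 - θ) := by nlinarith [hsplit, hsum]
    nlinarith [mul_nonneg (mul_nonneg hT0 hM.le) hθ]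
  exact le_of_mul_le_mul_right hmain hM

/-- The rows of the inclusion graph: position sets of size `s` and tuples.
[cite: ImpagliazzoEtAl2010, Def. 2.6] -/
def rows (k s : ℕ) (U : Type*) [Fintype U] :
    Finset (Finset (Fin k) × (Fin k → U)) :=
  (univ.powersetCard s) ×ˢ univ

omit C f in
/-- There are `C(k,s) · |U|^k` rows. [folklore] -/
theorem card_rows (s : ℕ) :
    (rows k s U).card = k.choose s * Fintype.card (Fin k → U) := by
  rw [rows, card_product, card_powersetCard, card_univ, Fintype.card_fin, card_univ]

omit C f in
/-- Membership in `rows`. [folklore] -/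
theorem mem_rows {s : ℕ} {p : Finset (Fin k) × (Fin k → U)} :
    p ∈ rows k s U ↔ p.1.card = s := by
  simp [rows, mem_powersetCard]

/-- Summing the number of correct completions over all rows counts every correct tuple
`C(k,s)·|U|^k` times. [cite: ImpagliazzoEtAl2010, Lemma 3.12 (proof)] -/
theorem sum_rows_card_corr (s : ℕ) :
    ∑ p ∈ rows k s U, ((corr C f p.1 p.2).card : ℝ) =
      k.choose s * Fintype.card (Fin k → U) *
        (univ.filter fun B : Fin k → U => errSet C f B = ∅).card := by
  rw [rows, Finset.sum_product]
  have hinner : ∀ P : Finset (Fin k), ∑ a : Fin k → U, ((corr C f P a).card : ℝ) =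
      Fintype.card (Fin k → U) * (univ.filter fun B : Fin k → U => errSet C f B = ∅).card := by
    intro P
    have h := sum_sum_fill (U := U) P (fun B => if errSet C f B = ∅ then (1 : ℝ) else 0)
    simp only [Finset.sum_boole] at h
    convert h using 2 with a
    simp [corr]
  simp only [hinner, Finset.sum_const, card_powersetCard, card_univ, Fintype.card_fin,
    nsmul_eq_mul]
  ring

/-- **Good rows are abundant** (IJKW Lemma 3.12, true-value variant): if `C` computes `f^k`
on at least an `ε` fraction of the tuples, then at least an `ε - ε'` fraction of the rows `(P, a)`
are good (have `≥ ε'` correct completions). [cite: ImpagliazzoEtAl2010, Lemma 3.12] -/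
theorem card_good_ge [Nonempty U] {s : ℕ} {ε ε' : ℝ} (hε' : 0 ≤ ε')
    (hC : ε * Fintype.card (Fin k → U) ≤
      ((univ.filter fun B : Fin k → U => errSet C f B = ∅).card : ℝ)) :
    (ε - ε') * (rows k s U).card ≤
      (((rows k s U).filter fun p : Finset (Fin k) × (Fin k → U) =>
        Good C f ε' p.1 p.2).card : ℝ) := by
  have hK : (0 : ℝ) < Fintype.card (Fin k → U) := Nat.cast_pos.2 Fintype.card_pos
  have h := card_filter_ge_of_sum_ge (rows k s U)
    (fun p : Finset (Fin k) × (Fin k → U) => ((corr C f p.1 p.2).card : ℝ))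
    (M := Fintype.card (Fin k → U)) (ρ := ε) (θ := ε') hK hε'
    (fun p _ => by exact_mod_cast (card_filter_le _ _).trans_eq card_univ) (by
      rw [sum_rows_card_corr, card_rows, Nat.cast_mul]
      have hb : (0 : ℝ) ≤ k.choose s := Nat.cast_nonneg _
      nlinarith [mul_le_mul_of_nonneg_left hC (mul_nonneg hb hK.le)])
  simpa [Good] using h

/-! ### Excellent rows are abundant (IJKW Lemma 3.11) -/

/-- The errors of the consistent completions of `(P, a)` having MORE than `θ` errors (the part
of `consErr` that excellence must control). [cite: ImpagliazzoEtAl2010, Lemma 3.11 (proof, (3))] -/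
noncomputable def consErrHeavy (θ : ℝ) (P : Finset (Fin k)) (a : Fin k → U) : ℕ :=
  ∑ y ∈ (cons C f P a).filter (fun y => θ < (errSet C f (fill P a y)).card),
    (errSet C f (fill P a y)).card

/-- `consErr ≤ θ |Cons| + consErrHeavy θ`. [cite: ImpagliazzoEtAl2010, Lemma 3.11 (proof)] -/
theorem consErr_le_add_consErrHeavy {θ : ℝ} (hθ : 0 ≤ θ) (P : Finset (Fin k)) (a : Fin k → U) :
    (consErr C f P a : ℝ) ≤ θ * (cons C f P a).card + consErrHeavy C f θ P a := by
  unfold consErr consErrHeavy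
  push_cast
  rw [← Finset.sum_filter_add_sum_filter_not (cons C f P a)
    (fun y => θ < ((errSet C f (fill P a y)).card : ℝ)), add_comm]
  refine add_le_add ?_ le_rfl
  calc (∑ y ∈ (cons C f P a).filter (fun y => ¬ θ < ((errSet C f (fill P a y)).card : ℝ)),
          ((errSet C f (fill P a y)).card : ℝ))
      ≤ ∑ _y ∈ (cons C f P a).filter (fun y => ¬ θ < ((errSet C f (fill P a y)).card : ℝ)), θ :=
        Finset.sum_le_sum fun y hy => not_lt.1 (mem_filter.1 hy).2
    _ ≤ θ * (cons C f P a).card := by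
        rw [Finset.sum_const, nsmul_eq_mul, mul_comm]
        exact mul_le_mul_of_nonneg_left (by exact_mod_cast card_filter_le _ _) hθ

/-- A good row that is not `α`-excellent has a heavy error mass `> θ ε' |U|^k` for
`θ = α (k - |P|) / 2`. [cite: ImpagliazzoEtAl2010, Lemma 3.11 (proof, event E₁)] -/
theorem lt_consErrHeavy_of_good_not_excellent {ε' α : ℝ} (hα : 0 ≤ α) {P : Finset (Fin k)}
    {a : Fin k → U} (hP : P.card ≤ k) (hg : Good C f ε' P a) (hne : ¬ Excellent C f ε' α P a) :
    α * (k - P.card) / 2 * (ε' * Fintype.card (Fin k → U)) <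
      consErrHeavy C f (α * (k - P.card) / 2) P a := by
  have hθ : 0 ≤ α * (k - P.card) / 2 := by
    have : (P.card : ℝ) ≤ k := by exact_mod_cast hP
    have := mul_nonneg hα (sub_nonneg.2 this)
    linarith
  have h1 := consErr_le_add_consErrHeavy C f hθ P a
  have h2 : ¬ (consErr C f P a : ℝ) ≤ α * (k - P.card) * (cons C f P a).card := fun h => hne ⟨hg, h⟩
  rw [not_le] at h2
  have hcorr : ((corr C f P a).card : ℝ) ≤ (cons C f P a).card := by
    exact_mod_cast card_le_card (corr_subset_cons C f P a)
  have hg' : ε' * Fintype.card (Fin k → U) ≤ (corr C f P a).card := hg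
  nlinarith [mul_le_mul_of_nonneg_left (hg'.trans hcorr) hθ]

/-- Summing the heavy error mass over all rows: every tuple `B` with `> θ` errors contributes
`|Err B|` once for each position set avoiding `Err B` (times `|U|^k` for the ignored
coordinates). [cite: ImpagliazzoEtAl2010, Lemma 3.11 (proof, the event E)] -/
theorem sum_rows_consErrHeavy (s : ℕ) (θ : ℝ) :
    ∑ p ∈ rows k s U, (consErrHeavy C f θ p.1 p.2 : ℝ) =
      Fintype.card (Fin k → U) * ∑ B : Fin k → U,
        if θ < (errSet C f B).card then
          ((errSet C f B).card : ℝ) *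
            ((univ.powersetCard s).filter fun P => Disjoint P (errSet C f B)).card
        else 0 := by
  rw [rows, Finset.sum_product]
  -- each row sum is a sum over all pairs `(a, y)` of a function of `fill P a y`
  have hinner : ∀ P : Finset (Fin k), ∑ a : Fin k → U, (consErrHeavy C f θ P a : ℝ) =
      Fintype.card (Fin k → U) * ∑ B : Fin k → U,
        if Disjoint P (errSet C f B) ∧ θ < (errSet C f B).card then ((errSet C f B).card : ℝ)
        else 0 := by
    intro P
    rw [← sum_sum_fill (U := U) P]
    refine Finset.sum_congr rfl fun a _ => ?_
    unfold consErrHeavy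
    push_cast
    rw [Finset.sum_filter, cons, Finset.sum_filter]
    refine Finset.sum_congr rfl fun y _ => ?_
    rw [ite_and]
  simp only [hinner, ← Finset.mul_sum]
  congr 1
  rw [Finset.sum_comm]
  refine Finset.sum_congr rfl fun B _ => ?_
  by_cases hθ : θ < (errSet C f B).card
  · simp only [hθ, and_true, if_true]
    rw [← Finset.sum_filter, Finset.sum_const, nsmul_eq_mul, mul_comm]
  · simp [hθ]

omit [Fintype U] in
/-- The hitting estimate for one tuple: if `θ < |Err B| ≤ k` then
`|Err B| · #{P : |P| = s, P ∩ Err B = ∅} ≤ k · exp(-s θ / k) · C(k, s)`.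
[cite: ImpagliazzoEtAl2010, Lemma 3.11 (proof, use of the sampler ν)] -/
theorem errCard_mul_card_avoiding_le (hk : 0 < k) (s : ℕ) {θ : ℝ} (B : Fin k → U)
    (hB : θ < (errSet C f B).card) :
    ((errSet C f B).card : ℝ) *
        ((univ.powersetCard s).filter fun P => Disjoint P (errSet C f B)).card ≤
      k * exp (-(s * θ / k)) * k.choose s := by
  haveI : Nonempty (Fin k) := ⟨⟨0, hk⟩⟩
  have h := card_avoiding_le_exp (α := Fin k) (errSet C f B) s
  rw [Fintype.card_fin] at h
  have he : ((errSet C f B).card : ℝ) ≤ k := by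
    exact_mod_cast (card_le_univ _).trans_eq (Fintype.card_fin k)
  have hexp : exp (-(s * (errSet C f B).card / k : ℝ)) ≤ exp (-(s * θ / k)) := by
    rw [exp_le_exp, neg_le_neg_iff]
    exact div_le_div_of_nonneg_right (mul_le_mul_of_nonneg_left hB.le (Nat.cast_nonneg _))
      (Nat.cast_nonneg _)
  calc ((errSet C f B).card : ℝ) *
        ((univ.powersetCard s).filter fun P => Disjoint P (errSet C f B)).card
      ≤ k * (exp (-(s * (errSet C f B).card / k : ℝ)) * k.choose s) :=
        mul_le_mul he h (by positivity) (Nat.cast_nonneg _)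
    _ ≤ k * (exp (-(s * θ / k)) * k.choose s) := by
        refine mul_le_mul_of_nonneg_left (mul_le_mul_of_nonneg_right hexp (Nat.cast_nonneg _))
          (Nat.cast_nonneg _)
    _ = k * exp (-(s * θ / k)) * k.choose s := by ring

/-- **Excellent rows are abundant** (IJKW Lemma 3.11, true-value variant, explicit constants).
With `θ = α (k - s) / 2`: if `C` is `ε`-correct and `k · exp(-s θ / k) ≤ ε'' · θ · ε'`, then at
least an `ε - ε' - ε''` fraction of the rows are `α`-excellent.
[cite: ImpagliazzoEtAl2010, Lemma 3.11] -/
theorem card_excellent_ge [Nonempty U] {s : ℕ} (hsk : s < k) {ε ε' ε'' α : ℝ} (hε' : 0 < ε')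
    (hα : 0 < α)
    (hC : ε * Fintype.card (Fin k → U) ≤
      ((univ.filter fun B : Fin k → U => errSet C f B = ∅).card : ℝ))
    (H1 : k * exp (-(s * (α * (k - s) / 2) / k)) ≤ ε'' * (α * (k - s) / 2) * ε') :
    (ε - ε' - ε'') * (rows k s U).card ≤
      (((rows k s U).filter fun p : Finset (Fin k) × (Fin k → U) =>
        Excellent C f ε' α p.1 p.2).card : ℝ) := by
  classical
  have hk : 0 < k := lt_of_le_of_lt (Nat.zero_le s) hsk
  set θ : ℝ := α * (k - s) / 2 with hθdef
  have hks : (0 : ℝ) < k - s := by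
    have : (s : ℝ) < k := by exact_mod_cast hsk
    linarith
  have hθ : 0 < θ := by positivity
  set K : ℝ := (Fintype.card (Fin k → U) : ℝ) with hKdef
  have hK : 0 < K := Nat.cast_pos.2 Fintype.card_pos
  set goodRows := (rows k s U).filter fun p : Finset (Fin k) × (Fin k → U) => Good C f ε' p.1 p.2
  set excRows := (rows k s U).filter fun p : Finset (Fin k) × (Fin k → U) =>
    Excellent C f ε' α p.1 p.2
  set badRows := (rows k s U).filter fun p : Finset (Fin k) × (Fin k → U) =>
    Good C f ε' p.1 p.2 ∧ ¬ Excellent C f ε' α p.1 p.2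
  -- good = excellent + bad
  have hsplit : (goodRows.card : ℝ) ≤ excRows.card + badRows.card := by
    have : goodRows ⊆ excRows ∪ badRows := by
      intro p hp
      rw [mem_filter] at hp
      by_cases he : Excellent C f ε' α p.1 p.2
      · exact mem_union_left _ (mem_filter.2 ⟨hp.1, he⟩)
      · exact mem_union_right _ (mem_filter.2 ⟨hp.1, hp.2, he⟩)
    exact_mod_cast (card_le_card this).trans (card_union_le _ _)
  have hgood := card_good_ge C f (s := s) hε'.le hC
  -- the bad rows carry heavy error mass `> θ ε' K` each
  have hbad_low : (badRows.card : ℝ) * (θ * (ε' * K)) ≤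
      ∑ p ∈ rows k s U, (consErrHeavy C f θ p.1 p.2 : ℝ) := by
    calc (badRows.card : ℝ) * (θ * (ε' * K)) = ∑ _p ∈ badRows, θ * (ε' * K) := by
          rw [Finset.sum_const, nsmul_eq_mul]
      _ ≤ ∑ p ∈ badRows, (consErrHeavy C f θ p.1 p.2 : ℝ) := by
          refine Finset.sum_le_sum fun p hp => ?_
          obtain ⟨hp, hg, hne⟩ := mem_filter.1 hp
          have hPs : p.1.card = s := mem_rows.1 hp
          have h := lt_consErrHeavy_of_good_not_excellent C f hα.le (P := p.1) (a := p.2)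
            (by omega) hg hne
          rw [hPs] at h
          exact h.le
      _ ≤ ∑ p ∈ rows k s U, (consErrHeavy C f θ p.1 p.2 : ℝ) :=
          Finset.sum_le_sum_of_subset_of_nonneg (filter_subset _ _) fun _ _ _ => Nat.cast_nonneg _
  -- and the total heavy error mass is small by the hitting property
  have hbad_up : ∑ p ∈ rows k s U, (consErrHeavy C f θ p.1 p.2 : ℝ) ≤
      K * (K * (k * exp (-(s * θ / k)) * k.choose s)) := by
    rw [sum_rows_consErrHeavy]
    refine mul_le_mul_of_nonneg_left ?_ hK.le
    calc (∑ B : Fin k → U, if θ < (errSet C f B).card then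
            ((errSet C f B).card : ℝ) *
              ((univ.powersetCard s).filter fun P => Disjoint P (errSet C f B)).card
            else 0)
        ≤ ∑ _B : Fin k → U, (k * exp (-(s * θ / k)) * k.choose s : ℝ) := by
          refine Finset.sum_le_sum fun B _ => ?_
          split_ifs with hB
          · exact errCard_mul_card_avoiding_le C f hk s B hB
          · positivity
      _ = K * (k * exp (-(s * θ / k)) * k.choose s) := by
          rw [Finset.sum_const, nsmul_eq_mul, card_univ]
  have hrows : ((rows k s U).card : ℝ) = k.choose s * K := by
    rw [card_rows]; push_cast; rfl
  -- combine: #bad ≤ ε'' |rows|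
  have hbad : (badRows.card : ℝ) ≤ ε'' * (rows k s U).card := by
    rw [hrows]
    have h3 : (badRows.card : ℝ) * (θ * (ε' * K)) ≤ K * (K * (ε'' * θ * ε' * k.choose s)) := by
      refine hbad_low.trans (hbad_up.trans ?_)
      refine mul_le_mul_of_nonneg_left (mul_le_mul_of_nonneg_left ?_ hK.le) hK.le
      calc (k : ℝ) * exp (-(s * θ / k)) * k.choose s ≤ ε'' * θ * ε' * k.choose s :=
            mul_le_mul_of_nonneg_right H1 (Nat.cast_nonneg _)
        _ = ε'' * θ * ε' * k.choose s := rfl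
    have hpos : 0 < θ * (ε' * K) := by positivity
    have : (badRows.card : ℝ) * (θ * (ε' * K)) ≤ (ε'' * (k.choose s * K)) * (θ * (ε' * K)) := by
      calc _ ≤ K * (K * (ε'' * θ * ε' * k.choose s)) := h3
        _ = (ε'' * (k.choose s * K)) * (θ * (ε' * K)) := by ring
    exact le_of_mul_le_mul_right this hpos
  linarith [hgood, hsplit, hbad]

end DirectProduct

end Literature.Computability.Complexity
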